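import Mathlib
import Literature.Analysis.UnboundedOperators.DiagonalOperator

/-!
# THEOREM 3-B-NESTED from matrix data: the REALITY clause (N7) — conjugation symmetry of the matrix
data gives `¬IsUnit R_z ⇒ ¬IsUnit R_{z̄}` (profile-cert-3 g5, cell `ns-blowup`, 2026-08-26)

HONEST FRAMING (human rulings D-0035/D-0074): nothing here is a claim about Navier–Stokes blow-up.
WHAT THIS IS NOT: not NS evidence. MODEL lane bookkeeping about the FORMAT of the F5 eigenpair
certificates of GROUP B. The reality step `BorderedEigenpairMasterNested.im_eq_zero_of_certified`
(p456956; (N7): `λ̃ ∈ ℝ`, `2ρ < r_iso` ⇒ `λ⋆ ∈ ℝ`) takes ONE model input,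
`hconj : ∀ z, ¬IsUnit R_z → ¬IsUnit R_{conj z}` (`R_z = 1 − T − (x₀ − z) S₀`) — assembly item (A5)
«L is real and the class is J-invariant». Here:

* `isUnit_resolventCoord_conj`: a CONJUGATE-LINEAR INVOLUTION `J` of `H` commuting with `S₀` and `T`
  (`x₀` real) transports invertibility: `IsUnit R_z ↔ IsUnit R_{conj z}` (pure bijectivity transport,
  `R_{z̄} = J ∘ R_z ∘ J`; no operator is constructed);
* `exists_conjugation_of_symmetric_data`: in a Hilbert basis `b`, an index involution `σ` with
  `conj d_{σ i} = d_i` and `t_{σ i, σ j} = conj t_{ij}` (for `T` acting in coordinates by the matrix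
  `t`, as the Schur-test operator does) yields such a `J`, `(J x)_i = conj x_{σ i}` — for the model this
  is instab4 g5's `AbcLatticeReality.crossForm_conj` (`σ = k ↦ −k`, Cartesian form);
* `hconj_of_symmetric_data`: the two combined = the hypothesis `hconj` of p456956 from MATRIX data.

Mathlib + the tree's `DiagonalOperator`; no new definitions. bears_on LADDER-NS N5 / Z4-a(1)(2);
evidence-only for `EpisodeBase` (stmt-NavierStokesRegularity-19179). [folklore] throughout.
-/

noncomputable section

namespace Summit.NavierStokesRegularity.FluidComputer.BorderedEigenpairConjugation

open scoped InnerProductSpace ComplexConjugate ENNReal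

variable {𝕜 H : Type*} [RCLike 𝕜] [NormedAddCommGroup H] [InnerProductSpace 𝕜 H] [CompleteSpace H]

/-! ## §1 Invertibility transport along a conjugate-linear involution -/

omit [CompleteSpace H] in
/-- `R_{conj z} (J x) = J (R_z x)` for a conjugate-linear `J` commuting with `S₀`, `T` (`x₀` real). -/
theorem resolventCoord_conj_apply (S₀ T : H →L[𝕜] H) (x₀ : ℝ) (J : H → H)
    (hJadd : ∀ x y, J (x + y) = J x + J y) (hJsmul : ∀ (c : 𝕜) (x : H), J (c • x) = conj c • J x)
    (hJS : ∀ x, J (S₀ x) = S₀ (J x)) (hJT : ∀ x, J (T x) = T (J x)) (z : 𝕜) (x : H) :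
    ((1 : H →L[𝕜] H) - T - ((x₀ : 𝕜) - conj z) • S₀) (J x) =
      J (((1 : H →L[𝕜] H) - T - ((x₀ : 𝕜) - z) • S₀) x) := by
  have hJneg : ∀ x, J (-x) = -J x := fun x => by
    have h := hJsmul (-1) x
    rwa [neg_one_smul, map_neg, map_one, neg_one_smul] at h
  have hJsub : ∀ x y, J (x - y) = J x - J y := fun x y => by
    rw [sub_eq_add_neg, hJadd, hJneg, ← sub_eq_add_neg]
  simp only [sub_apply, FunLike.coe_smul, Pi.smul_apply, one_apply_eq_self]
  rw [hJsub, hJsub, hJT, hJsmul, hJS, map_sub, RCLike.conj_ofReal]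

/-- **Invertibility transport.** `J : H → H` additive, conjugate-linear, involutive, commuting with
`S₀` and `T`, `x₀ ∈ ℝ`: `IsUnit R_z → IsUnit R_{conj z}` (`R_{z̄} = J R_z J` as maps; bijectivity +
`ContinuousLinearMap.isUnit_iff_bijective`). -/
theorem isUnit_resolventCoord_conj (S₀ T : H →L[𝕜] H) (x₀ : ℝ) (J : H → H)
    (hJadd : ∀ x y, J (x + y) = J x + J y) (hJsmul : ∀ (c : 𝕜) (x : H), J (c • x) = conj c • J x)
    (hJJ : ∀ x, J (J x) = x) (hJS : ∀ x, J (S₀ x) = S₀ (J x)) (hJT : ∀ x, J (T x) = T (J x))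
    (z : 𝕜) (hz : IsUnit ((1 : H →L[𝕜] H) - T - ((x₀ : 𝕜) - z) • S₀)) :
    IsUnit ((1 : H →L[𝕜] H) - T - ((x₀ : 𝕜) - conj z) • S₀) := by
  set Rz : H →L[𝕜] H := (1 : H →L[𝕜] H) - T - ((x₀ : 𝕜) - z) • S₀ with hRz
  set Rc : H →L[𝕜] H := (1 : H →L[𝕜] H) - T - ((x₀ : 𝕜) - conj z) • S₀ with hRc
  have hbij := ContinuousLinearMap.isUnit_iff_bijective.mp hz
  have hconj : ∀ x, Rc (J x) = J (Rz x) := fun x =>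
    resolventCoord_conj_apply S₀ T x₀ J hJadd hJsmul hJS hJT z x
  have hRcJ : ∀ x, Rc x = J (Rz (J x)) := fun x => by rw [← hconj, hJJ]
  have hJbij : Function.Bijective J :=
    ⟨fun x y h => by rw [← hJJ x, h, hJJ], fun y => ⟨J y, hJJ y⟩⟩
  refine ContinuousLinearMap.isUnit_iff_bijective.mpr ⟨fun x y h => ?_, fun y => ?_⟩
  · rw [hRcJ, hRcJ] at h
    exact hJbij.1 (hbij.1 (hJbij.1 h))
  · obtain ⟨x, hx⟩ := hbij.2 (J y)
    refine ⟨J x, ?_⟩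
    rw [hconj, hx, hJJ]

/-- The `hconj` form: `¬IsUnit R_z ⇒ ¬IsUnit R_{conj z}` (apply the transport to `conj z`). -/
theorem not_isUnit_resolventCoord_conj (S₀ T : H →L[𝕜] H) (x₀ : ℝ) (J : H → H)
    (hJadd : ∀ x y, J (x + y) = J x + J y) (hJsmul : ∀ (c : 𝕜) (x : H), J (c • x) = conj c • J x)
    (hJJ : ∀ x, J (J x) = x) (hJS : ∀ x, J (S₀ x) = S₀ (J x)) (hJT : ∀ x, J (T x) = T (J x))
    (z : 𝕜) (hz : ¬IsUnit ((1 : H →L[𝕜] H) - T - ((x₀ : 𝕜) - z) • S₀)) :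
    ¬IsUnit ((1 : H →L[𝕜] H) - T - ((x₀ : 𝕜) - conj z) • S₀) := by
  intro h
  have := isUnit_resolventCoord_conj S₀ T x₀ J hJadd hJsmul hJJ hJS hJT (conj z) h
  rw [RCLike.conj_conj] at this
  exact hz this

/-! ## §2 The conjugation from symmetric matrix data in a Hilbert basis -/

variable {ι : Type*} (b : HilbertBasis ι 𝕜 H)

omit [CompleteSpace H] in
/-- **The conjugation `(J x)_i = conj x_{σ i}` from an index involution.** If `σ` is an involution of
the index set, `conj d_{σ i} = d_i` (the resolvent symbol is real and `σ`-invariant) and the matrix of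
`T` (acting in coordinates, `(T x)_i = Σ' j, t_ij x_j`) satisfies `t_{σ i, σ j} = conj t_ij`, then there
is an additive, conjugate-linear involution `J` of `H` with `(J x)_i = conj x_{σ i}` commuting with
`S₀ = diag(d)` and with `T`. -/
theorem exists_conjugation_of_symmetric_data (σ : ι → ι) (hσ : Function.Involutive σ)
    (d : lp (fun _ : ι => 𝕜) ⊤) (hd : ∀ i, conj (d (σ i)) = d i) (T : H →L[𝕜] H) (t : ι → ι → 𝕜)
    (hcoord : ∀ x i, b.repr (T x) i = ∑' j, t i j * b.repr x j)
    (ht : ∀ i j, t (σ i) (σ j) = conj (t i j)) :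
    ∃ J : H → H, (∀ x i, b.repr (J x) i = conj (b.repr x (σ i))) ∧
      (∀ x y, J (x + y) = J x + J y) ∧ (∀ (c : 𝕜) (x : H), J (c • x) = conj c • J x) ∧
      (∀ x, J (J x) = x) ∧ (∀ x, J (b.diagonalCLM d x) = b.diagonalCLM d (J x)) ∧
      (∀ x, J (T x) = T (J x)) := by
  set e : ι ≃ ι := hσ.toPerm σ with he
  have he' : ∀ i, e i = σ i := fun i => rfl
  have h2 : (0 : ℝ) < (2 : ℝ≥0∞).toReal := by norm_num
  have hmem : ∀ x : H, Memℓp (fun i => conj (b.repr x (σ i))) 2 := by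
    intro x
    have hf := (memℓp_gen_iff h2).1 (lp.memℓp (b.repr x))
    refine (memℓp_gen_iff h2).2 ?_
    have heq : (fun i => ‖conj (b.repr x (σ i))‖ ^ (2 : ℝ≥0∞).toReal) =
        (fun i => ‖b.repr x i‖ ^ (2 : ℝ≥0∞).toReal) ∘ e := by
      funext i
      simp only [Function.comp_apply, he', RCLike.norm_conj]
    rw [heq]
    exact (Equiv.summable_iff e).2 hf
  set J : H → H := fun x => b.repr.symm ⟨fun i => conj (b.repr x (σ i)), hmem x⟩ with hJ
  have hJi : ∀ x i, b.repr (J x) i = conj (b.repr x (σ i)) := fun x i => by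
    simp only [hJ, LinearIsometryEquiv.apply_symm_apply]
  have hJadd : ∀ x y, J (x + y) = J x + J y := fun x y => by
    apply b.repr.injective
    ext i
    rw [map_add, lp.coeFn_add, Pi.add_apply, hJi, hJi, hJi, map_add, lp.coeFn_add, Pi.add_apply,
      map_add]
  have hJsmul : ∀ (c : 𝕜) (x : H), J (c • x) = conj c • J x := fun c x => by
    apply b.repr.injective
    ext i
    rw [LinearIsometryEquiv.map_smul, lp.coeFn_smul, Pi.smul_apply, hJi, hJi,
      LinearIsometryEquiv.map_smul, lp.coeFn_smul, Pi.smul_apply, smul_eq_mul, smul_eq_mul, map_mul]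
  have hJJ : ∀ x, J (J x) = x := fun x => by
    apply b.repr.injective
    ext i
    rw [hJi, hJi, hσ i, RCLike.conj_conj]
  have hJS : ∀ x, J (b.diagonalCLM d x) = b.diagonalCLM d (J x) := fun x => by
    apply b.repr.injective
    ext i
    rw [hJi, b.diagonalCLM_apply_repr, b.diagonalCLM_apply_repr, hJi, map_mul, hd]
  have hJT : ∀ x, J (T x) = T (J x) := fun x => by
    apply b.repr.injective
    ext i
    rw [hJi, hcoord, hcoord, ← RCLike.star_def, tsum_star]
    have hre : ∑' j, t i j * b.repr (J x) j = ∑' j, t i (σ j) * conj (b.repr x j) := by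
      rw [← Equiv.tsum_eq e (fun j => t i j * b.repr (J x) j)]
      exact tsum_congr fun j => by rw [he', hJi, hσ j]
    rw [hre]
    refine tsum_congr fun j => ?_
    rw [RCLike.star_def, map_mul]
    have h1 := ht (σ i) j
    rw [hσ i] at h1
    rw [h1]
  exact ⟨J, hJi, hJadd, hJsmul, hJJ, hJS, hJT⟩

/-- **`hconj` of p456956 from matrix data.** Under the hypotheses of
`exists_conjugation_of_symmetric_data` and `x₀ ∈ ℝ`: `¬IsUnit R_z ⇒ ¬IsUnit R_{conj z}` for every `z`,
`R_z = 1 − T − (x₀ − z) diag(d)`. -/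
theorem hconj_of_symmetric_data (σ : ι → ι) (hσ : Function.Involutive σ)
    (d : lp (fun _ : ι => 𝕜) ⊤) (hd : ∀ i, conj (d (σ i)) = d i) (T : H →L[𝕜] H) (t : ι → ι → 𝕜)
    (hcoord : ∀ x i, b.repr (T x) i = ∑' j, t i j * b.repr x j)
    (ht : ∀ i j, t (σ i) (σ j) = conj (t i j)) (x₀ : ℝ) (z : 𝕜)
    (hz : ¬IsUnit ((1 : H →L[𝕜] H) - T - ((x₀ : 𝕜) - z) • b.diagonalCLM d)) :
    ¬IsUnit ((1 : H →L[𝕜] H) - T - ((x₀ : 𝕜) - conj z) • b.diagonalCLM d) := by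
  obtain ⟨J, -, hJadd, hJsmul, hJJ, hJS, hJT⟩ :=
    exists_conjugation_of_symmetric_data b σ hσ d hd T t hcoord ht
  exact not_isUnit_resolventCoord_conj (b.diagonalCLM d) T x₀ J hJadd hJsmul hJJ hJS hJT z hz

end Summit.NavierStokesRegularity.FluidComputer.BorderedEigenpairConjugation

end
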